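import Mathlib
import Summits.NavierStokesRegularity.FluidComputer.AbcClassISynthesis
import Summits.NavierStokesRegularity.FluidComputer.AbcClassIISections
import Summits.NavierStokesRegularity.FluidComputer.AbcLinearisedPairing

/-!
# Class-I layer of the ABC certificate chains, Part E/P: energy identities on a Galerkin section, the
# `√2` pairing form bound, the tail constant and the non-vanishing border
(profile-cert-3 g9 — F5 implementation-3 seat, cell `ns-blowup`, 2026-08-27; the class-I twins of the parts of
instab4's `AbcClassIIEnergy` / `AbcClassIISectionsPrep`, instab3's `AbcClassIIOpenBracket` §1 and cert-3 g7's
`AbcClassIIEigenpairPrep` that the 3-B-nested chain consumes — same statements and proofs on the class-I basis)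

HONEST FRAMING (human rulings D-0035/D-0074): nothing here is a claim about Navier–Stokes blow-up.
WHAT THIS IS NOT: not NS evidence. MODEL lane (NS linearised about `abcFlow 1 1 1`, class I). Sequel of
`AbcClassISynthesis`.

* §E `sum_inner_section_lerayCrossForm` — the quadratic form of `Π X` on a section combination
  `ṽ = Σ_{j ∈ cubeIdx n} v_j bfam j` in coordinates; `sum_norm_sq_section` — Parseval on a section;
* §P `osupNorm_le_of_mem_nbrIdx`, `amat_eq_zero_of_shells` (the band does not skip a shell),
  `abs_re_pairing_form_le` — `|Re Σ conj(c_i) amat i j c_j| ≤ √2 Σ |c_j|²` on every section (the (A4)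
  pairing bound `AbcLatticePairingBound.abs_re_sum_inner_crossForm_le`, valid for ALL transversal families),
  and `section_pairing_amat` — the same on every finite index set (zero-padding);
* §Q (namespace `AbcClassIEigenpair`) `tail_const_off_shell` (`MU2 ≤ x + (K+2)²/R − √2` gives the tail
  constant off `cubeIdx (K+1)`; `AbcClassII.sq_osupNorm_le_onormSq` is character-free) and
  `exists_border_ne_zero` (a left inverse of the bordered Galerkin matrix forces `ṽ_h ≠ 0` on the head).

Mathlib + the files named; no new definitions. bears_on LADDER-NS N5 / Z4-a(1) (CR rows T2/T4).
-/

noncomputable section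

open scoped BigOperators ComplexConjugate InnerProductSpace
open Finset MeasureTheory UnitAddTorus

namespace Summit.NavierStokesRegularity.FluidComputer.AbcClassI

open Literature.Analysis.FunctionSpaces Literature.Analysis.FunctionSpaces.Torus
open Literature.Analysis.FunctionSpaces.EuclideanSpace
open Literature.Analysis.FluidPDE Literature.Analysis.FluidPDE.SteadyLattice
open Literature.Analysis.FluidPDE.ScalarFourier
open Summit.NavierStokesRegularity.FluidComputer.AbcClassII (Fam crossForm secOp rotR rotS sgnAct sgnOrbit
  cube extend restrictTo extend_add extend_smul extend_zero rotR_add rotR_smul rotS_add rotS_smul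
  crossForm_add crossForm_smul secOp_add secOp_smul restrictTo_add restrictTo_smul Orbit toOrbit onormSq
  osupNorm cubeOrbits nbrOrbits mem_sgnOrbit mem_sgnOrbit_self card_sgnOrbit_le sgnOrbit_eq_of_mem
  mem_sgnOrbit_comm sgnOrbit_eq_or_disjoint neg_mem_sgnOrbit neg_self_mem_sgnOrbit rotFreqR_mem_sgnOrbit
  rotFreqS_mem_sgnOrbit freqNormSq_eq_of_mem_sgnOrbit supNorm_eq_of_mem_sgnOrbit mem_cube
  mem_cube_iff_supNorm cube_mono sgnOrbit_subset_cube zero_not_mem_sgnOrbit ne_zero_of_mem_sgnOrbit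
  toOrbit_val toOrbit_eq_iff mem_cubeOrbits mem_nbrOrbits mem_nbrOrbits_comm card_nbrOrbits_le rotR_apply
  rotS_apply freqNormSq_rotFreq secOp_conj isConjSymm_secOp kdot_secOp mem_iff_of_orbitClosed
  isConjSymm_cut kdot_cut orbitClosed_cube_ne_zero orbitClosed_shell neg_mem_of_orbitClosed
  isConjSymm_lerayCrossForm kdot_conj conj_eq_zero_of_not_mem linOp_zero_eq conj_theta_neg
  extend_apply_of_mem extend_apply_of_not_mem restrictTo_extend extend_restrictTo extend_sum
  inner_eq_sum_extend inner_conjVec_conjVec conj_sum_inner_of_isConjSymm sum_inner_eq_re_of_isConjSymm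
  real_inner_eq_re real_smul_eq norm_lerayCrossForm_le sobolevWeight_one_eq cube_filter_eq_biUnion sum_cube_filter_eq
  onormSq_nonneg)

/-! ## Part E. The Galerkin energy identities on a class-I section -/

section Energy

/-- Orbits of `cubeIdx n` lie in the punctured cube `n`. -/
theorem orbit_subset_cube_filter {n : ℕ} {i : AbcClassI.Idx} (hi : i ∈ AbcClassI.cubeIdx n) :
    i.1.1 ⊆ (cube n).filter (fun k => k ≠ 0) := by
  intro k hk
  rw [Finset.mem_filter]
  refine ⟨mem_cube_iff_supNorm.mpr ?_, i.1.ne_zero_of_mem hk⟩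
  rw [i.1.supNorm_eq hk]; exact mem_cubeIdx.mp hi

/-- A section combination vanishes off the punctured cube. -/
theorem sectionFam_eq_zero_of_not_mem {n : ℕ} (v : AbcClassI.Idx → ℂ) {k : Fin 3 → ℤ}
    (hk : k ∉ (cube n).filter (fun k => k ≠ 0)) : (∑ j ∈ AbcClassI.cubeIdx n, v j • AbcClassI.bfam j) k = 0 :=
  sum_smul_bfam_apply_eq_zero (cubeIdx n) (fun j => j) v fun _ hj hkj => hk (orbit_subset_cube_filter hj hkj)

/-- **Pairing of a section combination against its basis family**:
`Σ_{k ∈ O_i} ⟪bfam i k, Π_k X(Σ_j v_j bfam j)(k)⟫ = Σ_j amat i j · v_j`. -/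
theorem sum_inner_bfam_lerayCrossForm_section (T : Finset AbcClassI.Idx) (v : AbcClassI.Idx → ℂ) (i : AbcClassI.Idx) :
    ∑ k ∈ i.1.1, (inner ℂ (AbcClassI.bfam i k) (Torus.lerayCoeff k (crossForm 1 1 1 (∑ j ∈ T, v j • AbcClassI.bfam j) k)) : ℂ) =
      ∑ j ∈ T, ((AbcClassI.amat i j : ℝ) : ℂ) * v j := by
  have e : ∀ k, (inner ℂ (bfam i k) (Torus.lerayCoeff k (crossForm 1 1 1 (∑ j ∈ T, v j • bfam j) k)) : ℂ) =
      ∑ j ∈ T, v j * (inner ℂ (bfam i k) (Torus.lerayCoeff k (crossForm 1 1 1 (bfam j) k)) : ℂ) := by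
    intro k
    have hL := lerayCrossForm_sum_smul T (fun j => j) v k
    rw [hL, inner_sum]
    exact Finset.sum_congr rfl fun j _ => by rw [inner_smul_right]
  rw [Finset.sum_congr rfl fun k _ => e k, Finset.sum_comm]
  refine Finset.sum_congr rfl fun j _ => ?_
  rw [← Finset.mul_sum, ← amat_eq i j, mul_comm]

/-- **The quadratic form of `Π X` on a section combination, in coordinates**:
`Σ_{k ∈ cube n∖0} ⟪ṽ k, Π_k X ṽ k⟫ = Σ_{i} conj(v_i) Σ_j amat i j v_j` for `ṽ = Σ_{j ∈ cubeIdx n} v_j bfam j`. -/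
theorem sum_inner_section_lerayCrossForm (n : ℕ) (v : AbcClassI.Idx → ℂ) :
    ∑ k ∈ (cube n).filter (fun k => k ≠ 0),
      (inner ℂ ((∑ j ∈ AbcClassI.cubeIdx n, v j • AbcClassI.bfam j) k)
        (Torus.lerayCoeff k (crossForm 1 1 1 (∑ j ∈ AbcClassI.cubeIdx n, v j • AbcClassI.bfam j) k)) : ℂ) =
      ∑ i ∈ AbcClassI.cubeIdx n, (starRingEnd ℂ) (v i) * ∑ j ∈ AbcClassI.cubeIdx n, ((AbcClassI.amat i j : ℝ) : ℂ) * v j := by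
  set S := (cube n).filter (fun k => k ≠ 0) with hS
  set g : Fam := fun k => Torus.lerayCoeff k (crossForm 1 1 1 (∑ j ∈ cubeIdx n, v j • bfam j) k) with hg
  have e1 : ∀ k, (inner ℂ ((∑ j ∈ cubeIdx n, v j • bfam j) k) (g k) : ℂ) =
      ∑ i ∈ cubeIdx n, (starRingEnd ℂ) (v i) * (inner ℂ (bfam i k) (g k) : ℂ) := by
    intro k
    rw [sum_smul_bfam_apply (cubeIdx n) (fun j => j) v k, sum_inner]
    exact Finset.sum_congr rfl fun i _ => by rw [inner_smul_left]
  change ∑ k ∈ S, (inner ℂ ((∑ j ∈ cubeIdx n, v j • bfam j) k) (g k) : ℂ) = _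
  rw [Finset.sum_congr rfl fun k _ => e1 k, Finset.sum_comm]
  refine Finset.sum_congr rfl fun i hi => ?_
  rw [← Finset.mul_sum]
  congr 1
  -- reduce the sum over the punctured cube to the orbit of `i`
  rw [← Finset.sum_subset (orbit_subset_cube_filter hi) (fun k _ hk => by
    rw [bfam_apply_of_not_mem i hk, inner_zero_left])]
  exact sum_inner_bfam_lerayCrossForm_section (cubeIdx n) v i

/-- **Parseval for a section combination**: `Σ_{k ∈ cube n∖0} ‖ṽ k‖² = Σ_{j ∈ cubeIdx n} ‖v_j‖²`. -/
theorem sum_norm_sq_section (n : ℕ) (v : AbcClassI.Idx → ℂ) :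
    ∑ k ∈ (cube n).filter (fun k => k ≠ 0), ‖(∑ j ∈ AbcClassI.cubeIdx n, v j • AbcClassI.bfam j) k‖ ^ 2 =
      ∑ j ∈ AbcClassI.cubeIdx n, ‖v j‖ ^ 2 := by
  rw [sum_cube_filter_eq, sum_cubeIdx_eq n (fun j => ‖v j‖ ^ 2)]
  refine Finset.sum_congr rfl fun O hO => ?_
  rw [← sum_norm_sq_orbitExpansion O v]
  refine Finset.sum_congr rfl fun k hk => ?_
  congr 2
  -- on the orbit `O` the section combination is its `O`-part
  rw [sum_smul_bfam_apply (cubeIdx n) (fun j => j) v k, Finset.sum_apply]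
  have e : (∑ j ∈ cubeIdx n, v j • bfam j k) =
      ∑ O' ∈ cubeOrbits n, ∑ a : Fin (odim O'), v ⟨O', a⟩ • bfam ⟨O', a⟩ k :=
    Finset.sum_sigma (cubeOrbits n) (fun O' => (Finset.univ : Finset (Fin (odim O')))) (fun j => v j • bfam j k)
  rw [e, Finset.sum_eq_single O]
  · rfl
  · intro O' _ hne
    refine Finset.sum_eq_zero fun a _ => ?_
    have hnot : k ∉ O'.1 := fun h => hne (Subtype.ext ((O'.sgnOrbit_eq h).symm.trans (O.sgnOrbit_eq hk)))
    rw [bfam_apply_of_not_mem ⟨O', a⟩ hnot, smul_zero]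
  · intro hnot; exact absurd hO hnot

end Energy

/-! ## Part P. Shell separation of the band; the `√2` pairing form bound -/

section SectionsPrep

/-- **Adjacent orbits lie in adjacent sup-norm shells**: `j ∈ nbrIdx i ⇒ |‖O_i‖_∞ − ‖O_j‖_∞| ≤ 1`. -/
theorem osupNorm_le_of_mem_nbrIdx {i j : AbcClassI.Idx} (h : j ∈ AbcClassI.nbrIdx i) :
    osupNorm i.1 ≤ osupNorm j.1 + 1 ∧ osupNorm j.1 ≤ osupNorm i.1 + 1 := by
  obtain ⟨k, hk, s, hs, hks⟩ := mem_nbrOrbits.mp (mem_nbrIdx.mp h)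
  rw [← i.1.supNorm_eq hk, ← j.1.supNorm_eq hks]
  have hb := fun m => AbcLatticeLocality.abs_sub_abcFreq_bounds k hs m
  constructor
  · refine Finset.sup_le fun m _ => ?_
    have h1 : (k m).natAbs ≤ ((k - s) m).natAbs + 1 := by
      have := (hb m).1
      rw [Int.abs_eq_natAbs, Int.abs_eq_natAbs] at this
      omega
    exact h1.trans (Nat.add_le_add_right (AbcClassII.natAbs_le_supNorm (k - s) m) 1)
  · refine Finset.sup_le fun m _ => ?_
    have h1 : ((k - s) m).natAbs ≤ (k m).natAbs + 1 := by
      have := (hb m).2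
      rw [Int.abs_eq_natAbs, Int.abs_eq_natAbs] at this
      omega
    exact h1.trans (Nat.add_le_add_right (AbcClassII.natAbs_le_supNorm k m) 1)

/-- **The band does not skip a shell**: `amat i j = 0` when the orbits of `i` and `j` are two or more
sup-norm shells apart (head ↔ deep blocks of every finer section vanish, SKEWCUT-CERT (F3)). -/
theorem amat_eq_zero_of_shells {i j : AbcClassI.Idx} (h : osupNorm i.1 + 2 ≤ osupNorm j.1 ∨ osupNorm j.1 + 2 ≤ osupNorm i.1) :
    AbcClassI.amat i j = 0 := by
  refine amat_eq_zero_of_not_mem fun hmem => ?_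
  have := osupNorm_le_of_mem_nbrIdx hmem
  omega

/-- **The pairing form of the first-order matrix is bounded by `√2`** on every complex coefficient
vector of a section: `|Re Σ_{i,j ∈ cubeIdx n} conj(c_i) amat i j c_j| ≤ √2 Σ_j |c_j|²`
(the (A4) pairing bound `AbcLatticePairingBound.abs_re_sum_inner_crossForm_le` on the section
combination `Σ_j c_j bfam j`; covers head, shell and tail vectors by zero-padding). -/
theorem abs_re_pairing_form_le (n : ℕ) (c : AbcClassI.Idx → ℂ) :
    |(∑ i ∈ AbcClassI.cubeIdx n, (starRingEnd ℂ) (c i) * ∑ j ∈ AbcClassI.cubeIdx n, ((AbcClassI.amat i j : ℝ) : ℂ) * c j).re| ≤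
      Real.sqrt 2 * ∑ j ∈ AbcClassI.cubeIdx n, ‖c j‖ ^ 2 := by
  classical
  set f : Fam := ∑ j ∈ cubeIdx n, c j • bfam j with hf
  set S := (cube n).filter (fun k => k ≠ 0) with hS
  have hft : ∀ k : Fin 3 → ℤ, ∑ jj : Fin 3, ((k jj : ℤ) : ℂ) * f k jj = 0 :=
    fun k => kdot_sum_smul_bfam (cubeIdx n) (fun j => j) c k
  have hfS : ∀ k ∉ S, f k = 0 := fun k hk => sectionFam_eq_zero_of_not_mem c hk
  have hpair := AbcLatticePairingBound.abs_re_sum_inner_crossForm_le f S hfS hft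
  change |(∑ k ∈ S, (inner ℂ (f k) (crossForm 1 1 1 f k) : ℂ)).re| ≤ Real.sqrt 2 * ∑ k ∈ S, ‖f k‖ ^ 2 at hpair
  have hproj : ∀ k ∈ S, (inner ℂ (f k) (crossForm 1 1 1 f k) : ℂ) =
      (inner ℂ (f k) (Torus.lerayCoeff k (crossForm 1 1 1 f k)) : ℂ) := by
    intro k hk
    rw [AbcLinearisedPairing.inner_lerayCoeff_of_transversal (Finset.mem_filter.mp hk).2 (hft k)]
  rw [Finset.sum_congr rfl hproj, hS, hf, sum_inner_section_lerayCrossForm n c, sum_norm_sq_section n c] at hpair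
  exact hpair

end SectionsPrep

/-! ### The section pairing hypothesis on every finite index set -/

section OpenBracket

/-- **The section pairing hypothesis for `amat` on every finite index set** (`s = √2`). -/
theorem section_pairing_amat (G : Finset AbcClassI.Idx) (u : AbcClassI.Idx → ℂ) :
    RCLike.re (∑ i ∈ G, ∑ j ∈ G, conj (u i) * ((AbcClassI.amat i j : ℝ) : ℂ) * u j) ≤
      Real.sqrt 2 * ∑ i ∈ G, ‖u i‖ ^ 2 := by
  classical
  -- a cube containing `G`
  set n : ℕ := G.sup fun i => osupNorm i.1 with hn
  have hG : G ⊆ cubeIdx n := fun i hi => mem_cubeIdx.mpr (Finset.le_sup (f := fun i => osupNorm i.1) hi)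
  -- zero-padding
  set v : Idx → ℂ := fun i => if i ∈ G then u i else 0 with hv
  have hvG : ∀ i ∉ G, v i = 0 := fun i hi => by simp only [hv, if_neg hi]
  have hvG' : ∀ i ∈ G, v i = u i := fun i hi => by simp only [hv, if_pos hi]
  have key := abs_re_pairing_form_le n v
  have hin : ∀ i, ∑ j ∈ cubeIdx n, ((amat i j : ℝ) : ℂ) * v j = ∑ j ∈ G, ((amat i j : ℝ) : ℂ) * u j := by
    intro i
    rw [← Finset.sum_subset hG fun j _ hj => by rw [hvG j hj, mul_zero]]
    exact Finset.sum_congr rfl fun j hj => by rw [hvG' j hj]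
  have hout : ∑ i ∈ cubeIdx n, (starRingEnd ℂ) (v i) * ∑ j ∈ cubeIdx n, ((amat i j : ℝ) : ℂ) * v j =
      ∑ i ∈ G, ∑ j ∈ G, conj (u i) * ((amat i j : ℝ) : ℂ) * u j := by
    rw [← Finset.sum_subset hG fun i _ hi => by rw [hvG i hi, map_zero, zero_mul]]
    refine Finset.sum_congr rfl fun i hi => ?_
    rw [hvG' i hi, hin i, Finset.mul_sum]
    exact Finset.sum_congr rfl fun j _ => by ring
  have hnorm : ∑ j ∈ cubeIdx n, ‖v j‖ ^ 2 = ∑ i ∈ G, ‖u i‖ ^ 2 := by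
    rw [← Finset.sum_subset hG fun j _ hj => by rw [hvG j hj, norm_zero]; ring]
    exact Finset.sum_congr rfl fun j hj => by rw [hvG' j hj]
  rw [hout, hnorm] at key
  rw [RCLike.re_to_complex]
  exact (le_abs_self _).trans key

end OpenBracket

end Summit.NavierStokesRegularity.FluidComputer.AbcClassI

/-! ## Part Q. The tail constant off the shell cube and the non-vanishing border (class-I index type) -/

namespace Summit.NavierStokesRegularity.FluidComputer.AbcClassIEigenpair

open Literature.Analysis.FunctionSpaces
open Summit.NavierStokesRegularity.FluidComputer.AbcClassI
open Summit.NavierStokesRegularity.FluidComputer.AbcClassII (Orbit onormSq osupNorm sq_osupNorm_le_onormSq)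

/-- **The tail constant off the shell cube**: if `MU2 ≤ x + (K+2)²/R − √2` (`R > 0`) then for every
orbit index outside `cubeIdx (K+1)` (equivalently: outside `cubeIdx K` and outside the shell
`cubeIdx (K+1) ∖ cubeIdx K`), `MU2 ≤ x − (−|O_i|²/R) − √2`. -/
theorem tail_const_off_shell {R : ℝ} (hR : 0 < R) (K : ℕ) {x MU2 : ℝ}
    (h : MU2 ≤ x + ((K : ℝ) + 2) ^ 2 / R - Real.sqrt 2) :
    ∀ i : AbcClassI.Idx, i ∉ AbcClassI.cubeIdx K → i ∉ AbcClassI.cubeIdx (K + 1) \ AbcClassI.cubeIdx K →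
      MU2 ≤ x - (-(onormSq i.1 / R)) - Real.sqrt 2 := by
  intro i hiK hish
  have hi : i ∉ cubeIdx (K + 1) := fun h' => hish (Finset.mem_sdiff.mpr ⟨h', hiK⟩)
  rw [mem_cubeIdx, not_le] at hi
  have h2 : ((K : ℝ) + 2) ^ 2 ≤ onormSq i.1 := by
    have h1 : ((K : ℝ) + 2) ≤ ((osupNorm i.1 : ℕ) : ℝ) := by exact_mod_cast hi
    exact (pow_le_pow_left₀ (by positivity) h1 2).trans (sq_osupNorm_le_onormSq i.1)
  have h3 : ((K : ℝ) + 2) ^ 2 / R ≤ onormSq i.1 / R := div_le_div_of_nonneg_right h2 hR.le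
  linarith

/-- **The border does not vanish on the head**: a left inverse of the bordered Galerkin matrix
`𝔅(c, m) = ((dg_i c_i − Σ_{j∈K} a_ij c_j + m ṽ_i)_{i∈K}, Σ_{i∈K} conj(ṽ_i) c_i)` forces `ṽ_i ≠ 0` for
some `i ∈ K` (otherwise `𝔅(0, 1) = 𝔅(0, 0)`). Generic in the diagonal `dg` and the matrix `a`. -/
theorem exists_border_ne_zero (K : Finset AbcClassI.Idx) (dg : AbcClassI.Idx → ℂ) (a : AbcClassI.Idx → AbcClassI.Idx → ℂ) (vt : AbcClassI.Idx → ℂ)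
    (Binv : ((↥K → ℂ) × ℂ) →ₗ[ℂ] ((↥K → ℂ) × ℂ))
    (hBinv : ∀ (c : ↥K → ℂ) (m : ℂ),
      Binv (fun i : ↥K => dg i * c i - ∑ j : ↥K, a i j * c j + m * vt i,
        ∑ i : ↥K, conj (vt i) * c i) = (c, m)) :
    ∃ i ∈ K, vt i ≠ 0 := by
  by_contra hall
  push Not at hall
  have h1 := hBinv (fun _ => 0) 1
  have h2 := hBinv (fun _ => 0) 0
  have e : (fun i : ↥K => dg i * (0 : ℂ) - ∑ j : ↥K, a i j * (0 : ℂ) + (1 : ℂ) * vt i,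
      ∑ i : ↥K, conj (vt i) * (0 : ℂ)) =
      (fun i : ↥K => dg i * (0 : ℂ) - ∑ j : ↥K, a i j * (0 : ℂ) + (0 : ℂ) * vt i,
      ∑ i : ↥K, conj (vt i) * (0 : ℂ)) := by
    refine Prod.ext (funext fun i => ?_) rfl
    simp [hall i i.2]
  have h3 := h1.symm.trans ((congrArg Binv e).trans h2)
  simpa using congrArg Prod.snd h3

end Summit.NavierStokesRegularity.FluidComputer.AbcClassIEigenpair

end
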